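import Literature.Analysis.PDE.HamiltonHarnackPairMaximumPrinciple
import Mathlib.Analysis.Calculus.Deriv.Inv
import Mathlib.Analysis.Calculus.Deriv.Pow
import Mathlib.Analysis.Calculus.Deriv.Mul
import Mathlib.Topology.Order.Compact
import HarnessLib

/-!
# Hamilton's matrix Harnack inequality for positive radial solutions of the heat equation on `S⁴`

Analysis/PDE support file (everything proved; no definitions, no named facts).  In the variable
`s = cos θ` a radial solution `u(s, τ)` of the heat equation on the round `S⁴` solves
`∂_τ u = (1-s²)∂²ₛu - 4s∂ₛu`; its logarithm `F = log u` has the radial and tangential Hessian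
eigenvalues `A = (1-s²)F₂ - sF₁` and `B = -sF₁` (`Fᵢ = ∂ⁱₛF`) along a geodesic through the pole.
R. S. Hamilton's matrix Harnack estimate (*A matrix Harnack estimate for the heat equation*,
Comm. Anal. Geom. 1 (1993) 113–126; the round sphere is Ricci parallel with positive curvature)
asserts `D²log u + g/(2τ) ≥ 0`, i.e. `A + 1/(2τ) ≥ 0` and `B + 1/(2τ) ≥ 0`.  We prove this for a
positive solution handed over through its jets `u₀ = u, u₁ = ∂ₛu, …, u₄ = ∂⁴ₛu` on
`[-1,1] × [0,T]` together with the time derivatives of `u₀, u₁, u₂` dictated by the equation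
(`harnack_of_radial_heat_jets`) — the form in which the polynomial Gegenbauer heat flows of
`GegenbauerHeatPositivity.lean` / `GegenbauerHeatJets.lean` come.

Proof (Hamilton §4–5 in one space variable): with `w = 1/u` the jets `Fᵢ` are polynomial in
`(w, u₁, …, u₄)` (`hasDerivAt_logJet*`); `A, B` satisfy the coupled evolution equations
`∂_τ A = L A + 2(1-s²)F₁ ∂ₛA + 2A² - 6F₂`, `∂_τ B = L B + 2(1-s²)F₁ ∂ₛB + 2F₂ + 2(1-s²)F₁² + 2B²`
(`L = (1-s²)∂²ₛ - 4s∂ₛ`, `A - B = (1-s²)F₂`; polynomial identities `harnack_identity_A/B`), and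
the weak maximum principle for this pair on `[-1,1]` (`HamiltonHarnackPairMaximumPrinciple.lean`;
no boundary condition at the degenerate endpoints), started at a small time `τ₀` at which
`1/(2τ₀)` dominates `|A|` and `|B|`, gives the claim.

## References
* R. S. Hamilton, Comm. Anal. Geom. 1 (1993) 113–126, Main Theorem, §4–5. [Hamilton1993Harnack]
* P. Li, S.-T. Yau, *On the parabolic kernel of the Schrödinger operator*, Acta Math. 156 (1986)
  153–201. [LiYau1986]
-/

noncomputable section

open Set Filter
open scoped Topology

namespace Literature.Analysis.PDE

/-! ### Jet calculus of `log u` in the space variable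

With `w = 1/u` (so that `∂ w = -u₁ w²`) the jets `F₁ = u₁ w`, `F₂ = u₂ w - u₁² w²`,
`F₃ = u₃ w - 3u₁u₂ w² + 2u₁³ w³`, `F₄ = u₄ w - 4u₁u₃ w² - 3u₂² w² + 12u₁²u₂ w³ - 6u₁⁴ w⁴` of
`F = log u` are polynomial in `(w, u₁, …, u₄)`, and every identity below is closed by `ring`. -/

/-- `∂ₛ F₁ = F₂`. [folklore] -/
theorem hasDerivAt_logJet1 {w u1 : ℝ → ℝ} {x a2 : ℝ} (hw : HasDerivAt w (-u1 x * w x ^ 2) x)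
    (h1 : HasDerivAt u1 a2 x) :
    HasDerivAt (fun y => u1 y * w y) (a2 * w x - u1 x ^ 2 * w x ^ 2) x :=
  (h1.fun_mul hw).congr_deriv (by ring)

/-- `∂ₛ F₂ = F₃`. [folklore] -/
theorem hasDerivAt_logJet2 {w u1 u2 : ℝ → ℝ} {x a3 : ℝ} (hw : HasDerivAt w (-u1 x * w x ^ 2) x)
    (h1 : HasDerivAt u1 (u2 x) x) (h2 : HasDerivAt u2 a3 x) :
    HasDerivAt (fun y => u2 y * w y - u1 y ^ 2 * w y ^ 2)
      (a3 * w x - 3 * u1 x * u2 x * w x ^ 2 + 2 * u1 x ^ 3 * w x ^ 3) x := by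
  have hu : HasDerivAt (fun y => u1 y ^ 2) (2 * u1 x * u2 x) x := by simpa using h1.fun_pow 2
  have hw2 : HasDerivAt (fun y => w y ^ 2) (2 * w x * (-u1 x * w x ^ 2)) x := by
    simpa using hw.fun_pow 2
  exact ((h2.fun_mul hw).sub (hu.fun_mul hw2)).congr_deriv (by ring)

/-- `∂ₛ F₃ = F₄`. [folklore] -/
theorem hasDerivAt_logJet3 {w u1 u2 u3 : ℝ → ℝ} {x a4 : ℝ} (hw : HasDerivAt w (-u1 x * w x ^ 2) x)
    (h1 : HasDerivAt u1 (u2 x) x) (h2 : HasDerivAt u2 (u3 x) x) (h3 : HasDerivAt u3 a4 x) :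
    HasDerivAt (fun y => u3 y * w y - 3 * u1 y * u2 y * w y ^ 2 + 2 * u1 y ^ 3 * w y ^ 3)
      (a4 * w x - 4 * u1 x * u3 x * w x ^ 2 - 3 * u2 x ^ 2 * w x ^ 2
        + 12 * u1 x ^ 2 * u2 x * w x ^ 3 - 6 * u1 x ^ 4 * w x ^ 4) x := by
  have hw2 : HasDerivAt (fun y => w y ^ 2) (2 * w x * (-u1 x * w x ^ 2)) x := by
    simpa using hw.fun_pow 2
  have hw3 : HasDerivAt (fun y => w y ^ 3) (3 * w x ^ 2 * (-u1 x * w x ^ 2)) x := by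
    simpa using hw.fun_pow 3
  have hq3 : HasDerivAt (fun y => u1 y ^ 3) (3 * u1 x ^ 2 * u2 x) x := by
    simpa using h1.fun_pow 3
  have hm : HasDerivAt (fun y => 3 * u1 y * u2 y) (3 * u2 x * u2 x + 3 * u1 x * u3 x) x :=
    (h1.const_mul 3).fun_mul h2
  exact (((h3.fun_mul hw).sub (hm.fun_mul hw2)).add ((hq3.const_mul 2).fun_mul hw3)).congr_deriv
    (by ring)

/-- `∂ₛ A` for `A = (1-s²)F₂ - sF₁`: `(1-s²)F₃ - 3sF₂ - F₁`. [folklore] -/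
theorem hasDerivAt_harnackA_s {F1 F2 : ℝ → ℝ} {x f3 : ℝ} (h1 : HasDerivAt F1 (F2 x) x)
    (h2 : HasDerivAt F2 f3 x) :
    HasDerivAt (fun y => (1 - y ^ 2) * F2 y - y * F1 y)
      ((1 - x ^ 2) * f3 - 3 * x * F2 x - F1 x) x := by
  have hq : HasDerivAt (fun y : ℝ => 1 - y ^ 2) (-(2 * x)) x := by
    simpa using (hasDerivAt_pow 2 x).const_sub 1
  exact ((hq.fun_mul h2).sub ((hasDerivAt_id' x).fun_mul h1)).congr_deriv (by ring)

/-- `∂ₛ (∂ₛA)`: `(1-s²)F₄ - 5sF₃ - 4F₂`. [folklore] -/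
theorem hasDerivAt_harnackA_ss {F1 F2 F3 : ℝ → ℝ} {x f4 : ℝ} (h1 : HasDerivAt F1 (F2 x) x)
    (h2 : HasDerivAt F2 (F3 x) x) (h3 : HasDerivAt F3 f4 x) :
    HasDerivAt (fun y => (1 - y ^ 2) * F3 y - 3 * y * F2 y - F1 y)
      ((1 - x ^ 2) * f4 - 5 * x * F3 x - 4 * F2 x) x := by
  have hq : HasDerivAt (fun y : ℝ => 1 - y ^ 2) (-(2 * x)) x := by
    simpa using (hasDerivAt_pow 2 x).const_sub 1
  have h3x : HasDerivAt (fun y : ℝ => 3 * y) 3 x := by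
    simpa using (hasDerivAt_id x).const_mul (3 : ℝ)
  exact (((hq.fun_mul h3).sub (h3x.fun_mul h2)).sub h1).congr_deriv (by ring)

/-- `∂ₛ B` for `B = -sF₁`: `-F₁ - sF₂`. [folklore] -/
theorem hasDerivAt_harnackB_s {F1 : ℝ → ℝ} {x f2 : ℝ} (h1 : HasDerivAt F1 f2 x) :
    HasDerivAt (fun y => -y * F1 y) (-F1 x - x * f2) x :=
  ((hasDerivAt_neg' x).fun_mul h1).congr_deriv (by ring)

/-- `∂ₛ (∂ₛB)`: `-2F₂ - sF₃`. [folklore] -/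
theorem hasDerivAt_harnackB_ss {F1 F2 : ℝ → ℝ} {x f3 : ℝ} (h1 : HasDerivAt F1 (F2 x) x)
    (h2 : HasDerivAt F2 f3 x) :
    HasDerivAt (fun y => -F1 y - y * F2 y) (-2 * F2 x - x * f3) x :=
  (h1.neg.sub ((hasDerivAt_id' x).fun_mul h2)).congr_deriv (by ring)

/-! ### Jet calculus of `log u` in the time variable -/

/-- `∂_τ F₁` along the flow `∂_τ u = (1-s²)u₂ - 4su₁`, `∂_τ u₁ = (1-s²)u₃ - 6su₂ - 4u₁`:
`(1-s²)F₃ - 6sF₂ - 4F₁ - 2sF₁² + 2(1-s²)F₁F₂`. [folklore] -/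
theorem hasDerivAt_logJet1_t {w v1 : ℝ → ℝ} {t s v2 v3 F1 F2 F3 : ℝ}
    (hw : HasDerivAt w (-((1 - s ^ 2) * v2 - 4 * s * v1 t) * w t ^ 2) t)
    (h1 : HasDerivAt v1 ((1 - s ^ 2) * v3 - 6 * s * v2 - 4 * v1 t) t)
    (hF1 : F1 = v1 t * w t) (hF2 : F2 = v2 * w t - v1 t ^ 2 * w t ^ 2)
    (hF3 : F3 = v3 * w t - 3 * v1 t * v2 * w t ^ 2 + 2 * v1 t ^ 3 * w t ^ 3) :
    HasDerivAt (fun r => v1 r * w r)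
      ((1 - s ^ 2) * F3 - 6 * s * F2 - 4 * F1 - 2 * s * F1 ^ 2 + 2 * (1 - s ^ 2) * F1 * F2) t := by
  refine (h1.fun_mul hw).congr_deriv ?_
  rw [hF1, hF2, hF3]
  ring

/-- `∂_τ F₂` along the flow (`∂_τ u₂ = (1-s²)u₄ - 8su₃ - 10u₂`):
`(1-s²)F₄ - 8sF₃ - 10F₂ - 2F₁² - 8sF₁F₂ + 2(1-s²)F₂² + 2(1-s²)F₁F₃`. [folklore] -/
theorem hasDerivAt_logJet2_t {w v1 v2 : ℝ → ℝ} {t s v3 v4 F1 F2 F3 F4 : ℝ}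
    (hw : HasDerivAt w (-((1 - s ^ 2) * v2 t - 4 * s * v1 t) * w t ^ 2) t)
    (h1 : HasDerivAt v1 ((1 - s ^ 2) * v3 - 6 * s * v2 t - 4 * v1 t) t)
    (h2 : HasDerivAt v2 ((1 - s ^ 2) * v4 - 8 * s * v3 - 10 * v2 t) t)
    (hF1 : F1 = v1 t * w t) (hF2 : F2 = v2 t * w t - v1 t ^ 2 * w t ^ 2)
    (hF3 : F3 = v3 * w t - 3 * v1 t * v2 t * w t ^ 2 + 2 * v1 t ^ 3 * w t ^ 3)
    (hF4 : F4 = v4 * w t - 4 * v1 t * v3 * w t ^ 2 - 3 * v2 t ^ 2 * w t ^ 2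
      + 12 * v1 t ^ 2 * v2 t * w t ^ 3 - 6 * v1 t ^ 4 * w t ^ 4) :
    HasDerivAt (fun r => v2 r * w r - v1 r ^ 2 * w r ^ 2)
      ((1 - s ^ 2) * F4 - 8 * s * F3 - 10 * F2 - 2 * F1 ^ 2 - 8 * s * F1 * F2
        + 2 * (1 - s ^ 2) * F2 ^ 2 + 2 * (1 - s ^ 2) * F1 * F3) t := by
  have hu : HasDerivAt (fun r => v1 r ^ 2)
      (2 * v1 t * ((1 - s ^ 2) * v3 - 6 * s * v2 t - 4 * v1 t)) t := by
    simpa using h1.fun_pow 2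
  have hw2 : HasDerivAt (fun r => w r ^ 2)
      (2 * w t * (-((1 - s ^ 2) * v2 t - 4 * s * v1 t) * w t ^ 2)) t := by
    simpa using hw.fun_pow 2
  refine ((h2.fun_mul hw).sub (hu.fun_mul hw2)).congr_deriv ?_
  rw [hF1, hF2, hF3, hF4]
  ring

/-! ### The evolution identities of `A` and `B` (Hamilton's computation, radial `S⁴`) -/

/-- **Evolution of the radial Hessian eigenvalue** `A = (1-s²)F₂ - sF₁` of `log V`, with the
shift `φ`: `∂_τ(A + φ) = L(A+φ) + 2(1-s²)F₁∂ₛA + 2(A-φ)(A+φ) - 6F₂` when `φ' = -2φ²` (a polynomial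
identity in the jets). [cite: Hamilton1993Harnack, §4 (evolution of the Harnack quantity)] -/
theorem harnack_identity_A (s F1 F2 F3 F4 φ : ℝ) :
    (1 - s ^ 2) * ((1 - s ^ 2) * F4 - 8 * s * F3 - 10 * F2 - 2 * F1 ^ 2 - 8 * s * F1 * F2
        + 2 * (1 - s ^ 2) * F2 ^ 2 + 2 * (1 - s ^ 2) * F1 * F3)
      - s * ((1 - s ^ 2) * F3 - 6 * s * F2 - 4 * F1 - 2 * s * F1 ^ 2 + 2 * (1 - s ^ 2) * F1 * F2)
      - 2 * φ ^ 2 =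
    (1 - s ^ 2) * ((1 - s ^ 2) * F4 - 5 * s * F3 - 4 * F2)
      - 4 * s * ((1 - s ^ 2) * F3 - 3 * s * F2 - F1)
      + 2 * F1 * (1 - s ^ 2) * ((1 - s ^ 2) * F3 - 3 * s * F2 - F1)
      + 2 * ((1 - s ^ 2) * F2 - s * F1 - φ) * ((1 - s ^ 2) * F2 - s * F1 + φ) - 6 * F2 := by
  ring

/-- **Evolution of the tangential Hessian eigenvalue** `B = -sF₁` of `log V`, with the shift
`φ`: `∂_τ(B + φ) ≥ L(B+φ) + 2(1-s²)F₁∂ₛB + 2(B-φ)(B+φ) + 2F₂` on `[-1,1]` (the dropped term is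
`2(1-s²)F₁² ≥ 0`). [cite: Hamilton1993Harnack, §4 (evolution of the Harnack quantity)] -/
theorem harnack_identity_B {s : ℝ} (hs : s ∈ Icc (-1 : ℝ) 1) (F1 F2 F3 φ : ℝ) :
    (1 - s ^ 2) * (-2 * F2 - s * F3) - 4 * s * (-F1 - s * F2)
      + 2 * F1 * (1 - s ^ 2) * (-F1 - s * F2)
      + 2 * (-s * F1 - φ) * (-s * F1 + φ) + 2 * F2 ≤
    -s * ((1 - s ^ 2) * F3 - 6 * s * F2 - 4 * F1 - 2 * s * F1 ^ 2 + 2 * (1 - s ^ 2) * F1 * F2)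
      - 2 * φ ^ 2 := by
  have h1 : 0 ≤ 1 - s ^ 2 := by nlinarith [hs.1, hs.2]
  nlinarith [mul_nonneg h1 (sq_nonneg F1)]

/-! ### The Harnack inequality for a positive radial solution given through its jets -/

/-- **Hamilton's matrix Harnack inequality, radial `S⁴`, for a positive solution given with its
jets.**  Let `u₀ > 0` on `[-1,1] × [0,T]` be jointly continuous together with `u₁, u₂`, with
`∂ₛuᵢ = uᵢ₊₁` (`i ≤ 3`) and the time derivatives `∂_τu₀ = (1-s²)u₂ - 4su₁`,
`∂_τu₁ = (1-s²)u₃ - 6su₂ - 4u₁`, `∂_τu₂ = (1-s²)u₄ - 8su₃ - 10u₂` (the radial heat equation of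
`S⁴` and its `s`-derivatives).  Then with `F₁ = u₁/u₀`, `F₂ = u₂/u₀ - u₁²/u₀²`:
`(1-s²)F₂ - sF₁ + 1/(2τ) ≥ 0` and `-sF₁ + 1/(2τ) ≥ 0` on `[-1,1] × (0,T]`.
[cite: Hamilton1993Harnack, Main Theorem and §4–5 (radial case on S⁴)] -/
theorem harnack_of_radial_heat_jets {u0 u1 u2 u3 u4 : ℝ → ℝ → ℝ} {T : ℝ}
    (hs01 : ∀ s τ, HasDerivAt (fun x => u0 x τ) (u1 s τ) s)
    (hs12 : ∀ s τ, HasDerivAt (fun x => u1 x τ) (u2 s τ) s)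
    (hs23 : ∀ s τ, HasDerivAt (fun x => u2 x τ) (u3 s τ) s)
    (hs34 : ∀ s τ, HasDerivAt (fun x => u3 x τ) (u4 s τ) s)
    (ht0 : ∀ s τ, HasDerivAt (fun t => u0 s t) ((1 - s ^ 2) * u2 s τ - 4 * s * u1 s τ) τ)
    (ht1 : ∀ s τ, HasDerivAt (fun t => u1 s t)
      ((1 - s ^ 2) * u3 s τ - 6 * s * u2 s τ - 4 * u1 s τ) τ)
    (ht2 : ∀ s τ, HasDerivAt (fun t => u2 s t)
      ((1 - s ^ 2) * u4 s τ - 8 * s * u3 s τ - 10 * u2 s τ) τ)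
    (hc0 : Continuous fun p : ℝ × ℝ => u0 p.1 p.2) (hc1 : Continuous fun p : ℝ × ℝ => u1 p.1 p.2)
    (hc2 : Continuous fun p : ℝ × ℝ => u2 p.1 p.2)
    (hpos : ∀ s ∈ Icc (-1 : ℝ) 1, ∀ τ ∈ Icc (0 : ℝ) T, 0 < u0 s τ) :
    ∀ s ∈ Icc (-1 : ℝ) 1, ∀ τ ∈ Ioc (0 : ℝ) T,
      0 ≤ (1 - s ^ 2) * (u2 s τ * (u0 s τ)⁻¹ - u1 s τ ^ 2 * (u0 s τ)⁻¹ ^ 2)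
            - s * (u1 s τ * (u0 s τ)⁻¹) + 1 / (2 * τ) ∧
        0 ≤ -s * (u1 s τ * (u0 s τ)⁻¹) + 1 / (2 * τ) := by
  intro s₁ hs₁ τ₁ hτ₁
  -- the jets of `log u₀`, polynomial in `w = 1/u₀`
  set w : ℝ → ℝ → ℝ := fun s τ => (u0 s τ)⁻¹ with hw
  set F1 : ℝ → ℝ → ℝ := fun s τ => u1 s τ * w s τ with hF1
  set F2 : ℝ → ℝ → ℝ := fun s τ => u2 s τ * w s τ - u1 s τ ^ 2 * w s τ ^ 2 with hF2
  set F3 : ℝ → ℝ → ℝ := fun s τ =>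
    u3 s τ * w s τ - 3 * u1 s τ * u2 s τ * w s τ ^ 2 + 2 * u1 s τ ^ 3 * w s τ ^ 3 with hF3
  set F4 : ℝ → ℝ → ℝ := fun s τ => u4 s τ * w s τ - 4 * u1 s τ * u3 s τ * w s τ ^ 2
    - 3 * u2 s τ ^ 2 * w s τ ^ 2 + 12 * u1 s τ ^ 2 * u2 s τ * w s τ ^ 3
    - 6 * u1 s τ ^ 4 * w s τ ^ 4 with hF4
  -- ### continuity and a priori bounds on `[-1,1] × [0,T]`
  have hK : IsCompact (Icc (-1 : ℝ) 1 ×ˢ Icc (0 : ℝ) T) := isCompact_Icc.prod isCompact_Icc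
  have hne0 : ∀ q ∈ Icc (-1 : ℝ) 1 ×ˢ Icc (0 : ℝ) T, u0 q.1 q.2 ≠ 0 :=
    fun q hq => (hpos q.1 hq.1 q.2 hq.2).ne'
  have hcw : ContinuousOn (fun q : ℝ × ℝ => w q.1 q.2) (Icc (-1 : ℝ) 1 ×ˢ Icc (0 : ℝ) T) :=
    hc0.continuousOn.inv₀ hne0
  have hcF1 : ContinuousOn (fun q : ℝ × ℝ => F1 q.1 q.2) (Icc (-1 : ℝ) 1 ×ˢ Icc (0 : ℝ) T) :=
    hc1.continuousOn.mul hcw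
  have hcF2 : ContinuousOn (fun q : ℝ × ℝ => F2 q.1 q.2) (Icc (-1 : ℝ) 1 ×ˢ Icc (0 : ℝ) T) :=
    (hc2.continuousOn.mul hcw).sub ((hc1.continuousOn.pow 2).mul (hcw.pow 2))
  have hcA : ContinuousOn (fun q : ℝ × ℝ => (1 - q.1 ^ 2) * F2 q.1 q.2 - q.1 * F1 q.1 q.2)
      (Icc (-1 : ℝ) 1 ×ˢ Icc (0 : ℝ) T) :=
    (((continuous_const.sub (continuous_fst.pow 2)).continuousOn).mul hcF2).sub
      (continuous_fst.continuousOn.mul hcF1)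
  have hcB : ContinuousOn (fun q : ℝ × ℝ => -q.1 * F1 q.1 q.2) (Icc (-1 : ℝ) 1 ×ˢ Icc (0 : ℝ) T) :=
    continuous_fst.continuousOn.neg.mul hcF1
  obtain ⟨MA, hMA⟩ := hK.exists_bound_of_continuousOn hcA
  obtain ⟨MB, hMB⟩ := hK.exists_bound_of_continuousOn hcB
  -- ### the initial time `τ₀ ≤ τ₁` with `1/(2τ₀) ≥ |A|, |B|`
  set M₀ : ℝ := |MA| + |MB| with hM₀
  have hM₀0 : 0 ≤ M₀ := by positivity
  set τ₀ : ℝ := min τ₁ (1 / (2 * M₀ + 2)) with hτ₀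
  have hτ₀pos : 0 < τ₀ := lt_min hτ₁.1 (by positivity)
  have hτ₀le : τ₀ ≤ τ₁ := min_le_left _ _
  have hτ₀T : τ₀ ≤ T := hτ₀le.trans hτ₁.2
  have hφ₀ : M₀ + 1 ≤ 1 / (2 * τ₀) := by
    rw [le_div_iff₀ (by positivity)]
    have h1 : τ₀ ≤ 1 / (2 * M₀ + 2) := min_le_right _ _
    have h2 : τ₀ * (2 * M₀ + 2) ≤ 1 := by rwa [le_div_iff₀ (by positivity)] at h1
    nlinarith
  -- membership bookkeeping
  have hbox : ∀ τ ∈ Ioc τ₀ T, τ ∈ Icc (0 : ℝ) T := fun τ hτ => ⟨(hτ₀pos.trans hτ.1).le, hτ.2⟩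
  -- ### the derivative of `w` and the jet identities at points of positivity
  have hws : ∀ s τ, u0 s τ ≠ 0 → HasDerivAt (fun x => w x τ) (-u1 s τ * w s τ ^ 2) s := by
    intro s τ hne
    refine ((hs01 s τ).inv hne).congr_deriv ?_
    simp only [hw, inv_pow, div_eq_mul_inv, neg_mul]
  have hwt : ∀ s τ, u0 s τ ≠ 0 →
      HasDerivAt (fun t => w s t) (-((1 - s ^ 2) * u2 s τ - 4 * s * u1 s τ) * w s τ ^ 2) τ := by
    intro s τ hne
    refine ((ht0 s τ).inv hne).congr_deriv ?_
    simp only [hw, inv_pow, div_eq_mul_inv, neg_mul]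
  have hF1s : ∀ s τ, u0 s τ ≠ 0 → HasDerivAt (fun x => F1 x τ) (F2 s τ) s :=
    fun s τ hne => hasDerivAt_logJet1 (hws s τ hne) (hs12 s τ)
  have hF2s : ∀ s τ, u0 s τ ≠ 0 → HasDerivAt (fun x => F2 x τ) (F3 s τ) s :=
    fun s τ hne => hasDerivAt_logJet2 (hws s τ hne) (hs12 s τ) (hs23 s τ)
  have hF3s : ∀ s τ, u0 s τ ≠ 0 → HasDerivAt (fun x => F3 x τ) (F4 s τ) s :=
    fun s τ hne => hasDerivAt_logJet3 (hws s τ hne) (hs12 s τ) (hs23 s τ) (hs34 s τ)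
  have hF1t : ∀ s τ, u0 s τ ≠ 0 → HasDerivAt (fun t => F1 s t)
      ((1 - s ^ 2) * F3 s τ - 6 * s * F2 s τ - 4 * F1 s τ - 2 * s * F1 s τ ^ 2
        + 2 * (1 - s ^ 2) * F1 s τ * F2 s τ) τ :=
    fun s τ hne => hasDerivAt_logJet1_t (hwt s τ hne) (ht1 s τ) rfl rfl rfl
  have hF2t : ∀ s τ, u0 s τ ≠ 0 → HasDerivAt (fun t => F2 s t)
      ((1 - s ^ 2) * F4 s τ - 8 * s * F3 s τ - 10 * F2 s τ - 2 * F1 s τ ^ 2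
        - 8 * s * F1 s τ * F2 s τ + 2 * (1 - s ^ 2) * F2 s τ ^ 2
        + 2 * (1 - s ^ 2) * F1 s τ * F3 s τ) τ :=
    fun s τ hne => hasDerivAt_logJet2_t (hwt s τ hne) (ht1 s τ) (ht2 s τ) rfl rfl rfl rfl
  have hφ : ∀ τ, 0 < τ → HasDerivAt (fun t : ℝ => 1 / (2 * t)) (-2 * (1 / (2 * τ)) ^ 2) τ := by
    intro τ hτ
    have h := (hasDerivAt_const τ (1 : ℝ)).fun_div ((hasDerivAt_id' τ).const_mul 2)
      (by positivity)
    refine h.congr_deriv ?_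
    field_simp
    ring
  -- ### bounds for the zeroth-order coefficients on `[-1,1] × [τ₀,T]`
  have hKτ : IsCompact (Icc (-1 : ℝ) 1 ×ˢ Icc τ₀ T) := isCompact_Icc.prod isCompact_Icc
  have hsubK : Icc (-1 : ℝ) 1 ×ˢ Icc τ₀ T ⊆ Icc (-1 : ℝ) 1 ×ˢ Icc (0 : ℝ) T :=
    prod_mono le_rfl (Icc_subset_Icc hτ₀pos.le le_rfl)
  have hcφ : ContinuousOn (fun q : ℝ × ℝ => 1 / (2 * q.2)) (Icc (-1 : ℝ) 1 ×ˢ Icc τ₀ T) :=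
    continuousOn_const.div (continuousOn_const.mul continuous_snd.continuousOn)
      fun q hq => by
        have h : τ₀ ≤ q.2 := hq.2.1
        exact mul_ne_zero two_ne_zero (hτ₀pos.trans_le h).ne'
  have hcN₁ : ContinuousOn (fun q : ℝ × ℝ => (1 - q.1 ^ 2) * F2 q.1 q.2 - q.1 * F1 q.1 q.2
      + 1 / (2 * q.2)) (Icc (-1 : ℝ) 1 ×ˢ Icc τ₀ T) := (hcA.mono hsubK).add hcφ
  have hcN₂ : ContinuousOn (fun q : ℝ × ℝ => -q.1 * F1 q.1 q.2 + 1 / (2 * q.2))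
      (Icc (-1 : ℝ) 1 ×ˢ Icc τ₀ T) := (hcB.mono hsubK).add hcφ
  obtain ⟨C₁, hC₁⟩ := hKτ.exists_bound_of_continuousOn ((hcA.mono hsubK).sub hcφ)
  obtain ⟨C₂, hC₂⟩ := hKτ.exists_bound_of_continuousOn ((hcB.mono hsubK).sub hcφ)
  -- ### the maximum principle
  have key := hamiltonPair_nonneg
    (N₁ := fun s τ => (1 - s ^ 2) * F2 s τ - s * F1 s τ + 1 / (2 * τ))
    (N₂ := fun s τ => -s * F1 s τ + 1 / (2 * τ))
    (D₁ := fun s τ => (1 - s ^ 2) * F3 s τ - 3 * s * F2 s τ - F1 s τ)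
    (D₂ := fun s τ => -F1 s τ - s * F2 s τ)
    (E₁ := fun s τ => (1 - s ^ 2) * F4 s τ - 5 * s * F3 s τ - 4 * F2 s τ)
    (E₂ := fun s τ => -2 * F2 s τ - s * F3 s τ)
    (T₁ := fun s τ => (1 - s ^ 2) * ((1 - s ^ 2) * F4 s τ - 8 * s * F3 s τ - 10 * F2 s τ
        - 2 * F1 s τ ^ 2 - 8 * s * F1 s τ * F2 s τ + 2 * (1 - s ^ 2) * F2 s τ ^ 2
        + 2 * (1 - s ^ 2) * F1 s τ * F3 s τ)
      - s * ((1 - s ^ 2) * F3 s τ - 6 * s * F2 s τ - 4 * F1 s τ - 2 * s * F1 s τ ^ 2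
        + 2 * (1 - s ^ 2) * F1 s τ * F2 s τ) + (-2 * (1 / (2 * τ)) ^ 2))
    (T₂ := fun s τ => -s * ((1 - s ^ 2) * F3 s τ - 6 * s * F2 s τ - 4 * F1 s τ
        - 2 * s * F1 s τ ^ 2 + 2 * (1 - s ^ 2) * F1 s τ * F2 s τ) + (-2 * (1 / (2 * τ)) ^ 2))
    (g := F2) (p := fun s τ => 2 * F1 s τ)
    (c₁ := fun s τ => 2 * ((1 - s ^ 2) * F2 s τ - s * F1 s τ - 1 / (2 * τ)))
    (c₂ := fun s τ => 2 * (-s * F1 s τ - 1 / (2 * τ))) (τ₀ := τ₀) (T := T)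
    (M := 2 * (|C₁| + |C₂|)) hcN₁ hcN₂
    (fun s hs τ hτ => (hasDerivAt_harnackA_s (hF1s s τ (hpos s hs τ (hbox τ hτ)).ne')
      (hF2s s τ (hpos s hs τ (hbox τ hτ)).ne')).add_const _)
    (fun s hs τ hτ => (hasDerivAt_harnackB_s (hF1s s τ (hpos s hs τ (hbox τ hτ)).ne')).add_const _)
    (fun s hs τ hτ => hasDerivAt_harnackA_ss (hF1s s τ (hpos s (Ioo_subset_Icc_self hs) τ
        (hbox τ hτ)).ne') (hF2s s τ (hpos s (Ioo_subset_Icc_self hs) τ (hbox τ hτ)).ne')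
      (hF3s s τ (hpos s (Ioo_subset_Icc_self hs) τ (hbox τ hτ)).ne'))
    (fun s hs τ hτ => hasDerivAt_harnackB_ss (hF1s s τ (hpos s (Ioo_subset_Icc_self hs) τ
        (hbox τ hτ)).ne') (hF2s s τ (hpos s (Ioo_subset_Icc_self hs) τ (hbox τ hτ)).ne'))
    (fun s hs τ hτ => ((((hF2t s τ (hpos s hs τ (hbox τ hτ)).ne').const_mul (1 - s ^ 2)).sub
      ((hF1t s τ (hpos s hs τ (hbox τ hτ)).ne').const_mul s)).add (hφ τ (hτ₀pos.trans hτ.1))))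
    (fun s hs τ hτ => (((hF1t s τ (hpos s hs τ (hbox τ hτ)).ne').const_mul (-s)).add
      (hφ τ (hτ₀pos.trans hτ.1))))
    (fun s hs τ hτ => by ring) (fun τ hτ => by ring) (fun τ hτ => by ring)
    (fun s hs τ hτ => by
      have h1 := hC₁ (s, τ) ⟨hs, hτ.1.le, hτ.2⟩
      simp only [Pi.sub_apply, Real.norm_eq_abs] at h1
      rw [abs_mul, abs_two]
      nlinarith [le_abs_self C₁, abs_nonneg C₂])
    (fun s hs τ hτ => by
      have h1 := hC₂ (s, τ) ⟨hs, hτ.1.le, hτ.2⟩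
      simp only [Pi.sub_apply, Real.norm_eq_abs] at h1
      rw [abs_mul, abs_two]
      nlinarith [le_abs_self C₂, abs_nonneg C₁])
    (fun s hs τ hτ => le_of_eq (by
      linear_combination -(harnack_identity_A s (F1 s τ) (F2 s τ) (F3 s τ) (F4 s τ)
        (1 / (2 * τ)))))
    (fun s hs τ hτ => by
      have h := harnack_identity_B hs (F1 s τ) (F2 s τ) (F3 s τ) (1 / (2 * τ))
      linarith)
    (fun s hs => by
      have hA := hMA (s, τ₀) ⟨hs, hτ₀pos.le, hτ₀T⟩
      have hB := hMB (s, τ₀) ⟨hs, hτ₀pos.le, hτ₀T⟩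
      rw [Real.norm_eq_abs] at hA hB
      constructor
      · nlinarith [neg_abs_le ((1 - s ^ 2) * F2 s τ₀ - s * F1 s τ₀), le_abs_self MA,
          abs_nonneg MB]
      · nlinarith [neg_abs_le (-s * F1 s τ₀), le_abs_self MB, abs_nonneg MA])
  exact key s₁ hs₁ τ₁ ⟨hτ₀le, hτ₁.2⟩

end Literature.Analysis.PDE
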